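/-
Copyright: statement-level skeleton of a published paper (lit-balaban cell, Phase-2 proof seat p32 gen 45). No claims beyond
what the kernel checks below.
-/
import Literature.MathematicalPhysics.QuantumFieldTheory.Balaban1983to89.B3OnePIChainGlue
import Literature.MathematicalPhysics.QuantumFieldTheory.Balaban1983to89.B3OddVectorLoopsVanish
import Literature.MathematicalPhysics.QuantumFieldTheory.Balaban1983to89.B3OnePIGraphs
import Literature.MathematicalPhysics.QuantumFieldTheory.Balaban1983to89.B3ClassOrders420

/-!
# B3 — T. Bałaban, *(Higgs)₂,₃ quantum fields in a finite volume. III. Renormalization*, CMP **88** (1983) 411–445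
[Balaban1983Higgs3] — p. 415 [PDF 5] (1.17) «graph» / p. 416 [PDF 6] (1.21)–(1.22) / p. 420 [PDF 10] d_s(G), d_v(G): FINITENESS
AT FIXED ORDER — the model has finitely many graphs, and finitely many two-leg insertions, with a given (or bounded) number
of vertices; hence finitely many classes of them at bounded order in ANY identification of graphs (e.g. up to isomorphism); a
bounded number of legs; and a CONNECTED graph has at most (n̄ + 5)·(d_s + d_v + counterterm orders) vertices, so that at each
coupling order the connected graphs of the expansion are FINITELY MANY

statement-level skeleton of published theorems with citation tags; proofs where landed; nothing here is a claim about
the Yang–Mills mass gap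

PDF held: `paper:balaban1983-higgs-2-3-quantum-fields-finite-volume` (journal page = PDF page + 410); pp. 415–416 read as
images this session on the ×2 renders `run/shared/lean/pub/pub-balaban/b2b-balaban-ref1/pages/1983-cmp88-higgs23-III/
1983-cmp88-higgs23-III-p005-x2.png` / `…-p006-x2.png` / `…-p007-x2.png` / `…-p010-x2.png` (pp. 415, 416, 417, 420).

CITATION HEADER (lean-in-tree rule).  lit-balaban TYPED SKELETON (HOME `run/shared/lean/pub/lit-balaban/`), PHASE 2, seat p32
gen 45 (unit `lit-balaban-p32`; TAKING line HOME/STATUS.md 2026-08-24T13:24:00Z, free-target protocol G.5-34(d)), rows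
**B3.Eq1.17-1.18** («graph», p. 415) and **B3.Eq1.19-1.22** ((1.21)–(1.22), p. 416) of `HOME/lit-balaban-r15/ROWS-B3.md` (fold
owner r15; both heads `proved`; this file is an OPTIONAL located member, zero head weight — it supplies the finiteness that the
p32 gen-44 HONEST SCOPE of `B3OnePIChainClasses` names as absent: *"no enumeration or finiteness of classes at fixed order"*).
CONSUMES BY NAME: r15's catalogue `B3Prop1.VertexKind` / `Admissible` / `scalarLegs` / `vectorLegs` / `ds` / `dv` ((1.6)–(1.15),
p. 420), p18's model `B3Cor23Concrete.Graph` / `Leg` (p. 415) and `B3OddVectorLoopsVanish.scalarLegs_le_four`, p37's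
`B3OnePIChainGlue.TwoLegGraph` ((1.21)) and `B3OnePIGraphs.Adj` / `IsConnected`, p33's `B3ClassOrders420.dsG` / `dvG` /
`ordersCt` / `ordersCt_zero` (d_s(G), d_v(G) and the counterterm bookkeeping of p. 420).  Nothing re-declared; no
declaration is added to another file's namespace.

THE PRINTED TEXT (verbatim).  p. 415: *"The above notations in (1.17) and (1.18) are not precise, but they can be made quite
precise if we specify a number and nature of legs. Now a graph for us is a collection of internal lines, external legs, and
vertices connected in the usual sense. There is at least one internal line, and every internal line has a vertex at each
endpoint. The construction of graphs is otherwise arbitrary."*  pp. 413–414, the side conditions of the catalogue: (1.8)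
*"n, n′ ≤ n̄, n + n′ ≥ 1"*, (1.9) *"n ≤ n̄"*, (1.10) *"n + n′ even, n, n′ ≤ n̄, n + n′ ≥ 2"*, (1.14) *"n, n′ ≤ n̄, n + n′ ≥ 1"*,
(1.15) *"n ≤ n̄"*.  p. 416, after (1.22): *"Here we did not write, and we will not write in the future, combinatoric factors
before the graphs, understanding that they are a part of the graphical description."*  p. 420: *"Let us denote by d_s(v) an
order of the coupling constant λ for the vertex v, and by d_v(v) an order of the coupling constant e. Finally let d_s(G) =
Σ_{v∈G} d_s(v), d_v(G) = Σ_{v∈G} d_v(v)."*  p. 417: *"More exactly we write δm² = Σ_{2≦α+2β≦4} e^αλ^βδm²_{(α,β)} and we insert this into Σ^ε."* (the mass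
counterterm carried by the vertex (1.7) starts at order two in the coupling constants).

KIND «(ours)» (G.5-54): print states no finiteness lemma; it USES that the expansion to a given order is a finite sum of graphs
(every "Σ over graphs G" of (1.17)–(1.22), (2.15), (3.5) at fixed order) and that combinatoric factors make sense.  On p18's
carrier this rests on three printed facts only — the side conditions bound every integer parameter of a vertex by n̄; a graph
is a finite amount of data (vertices from the catalogue, a pairing of finitely many legs); every vertex except (1.7) and (1.13)
carries a coupling constant, (1.7) carries δm² of order ≥ 2, and (1.13) has a single leg — and that is what is proved here.
Each declaration's cite tag locates the printed notion it serves: a CONTEXT locator, not a transcription (print asserts no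
finiteness statement explicitly; it is implicit in every fixed-order sum over graphs).

WHAT IS PROVED (theorems + `abbrev`/`def` plumbing with bodies; no `Prop` fact, no `sorry`; standard axioms).
* `§1` `catalogueOf` / `exists_catalogueOf_eq` (every admissible vertex is enumerated by a tag `< 9` and two parameters
  `≤ n̄`), **`finite_admissible : Set.Finite {v | v.Admissible n̄}`**, `finite_admKind : Finite {v // v.Admissible n̄}`.
* `§2` `RawGraph` (kinds + «other endpoint» map on `V` vertices; finite), `RawGraph.Valid` (the four printed conditions),
  `RawGraph.toGraph`, `toGraph_surjective`; **`finite_graph_nV_eq : Finite {G : Graph n̄ // G.nV = V}`**,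
  `finite_setOf_nV_eq`, **`finite_setOf_nV_le : Set.Finite {G | G.nV ≤ V}`**, `finite_graph_nV_le`,
  **`finite_image_nV_le`** (the image of the graphs with `≤ V` vertices under ANY map is finite) and its quotient form
  **`finite_classes_nV_le`** (for every setoid on graphs — e.g. isomorphism — finitely many classes are met at bounded order).
* `§3` the same for two-leg insertions: `RawTwoLeg`, `RawTwoLeg.Valid`, `toTwoLeg`, `toTwoLeg_surjective`,
  **`finite_twoLeg_nV_eq : Finite {T : TwoLegGraph n̄ // T.G.nV = V}`**, `finite_setOf_twoLeg_nV_eq`,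
  **`finite_setOf_twoLeg_nV_le`**, `finite_twoLeg_nV_le`, `finite_image_twoLeg_nV_le`, `finite_twoLeg_classes_nV_le`.
* `§4` leg count: `vectorLegs_le_of_admissible` (≤ n̄; the φ′-bound ≤ 4 is p18's `B3OddVectorLoopsVanish.scalarLegs_le_four`,
  reused BY NAME), **`card_leg_le : card (Leg G.kind) ≤ (n̄ + 4)·G.nV`**.
* `§5` `one_le_ds_add_dv` (an admissible vertex other than (1.7), (1.13) has d_s + d_v ≥ 1), `legs_v113`.
* `§6` the (1.13)-vertices of a connected graph: `subsingleton_fibre_of_v113`, `leg_eq_of_v113`, `legAt113` (+ `fst_legAt113`,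
  `eq_legAt113`), `adj_v113`, **`eq_or_eq_of_reachable_pair113`** (two (1.13)-vertices joined by a line are a whole
  component), `isSome_other_legAt113`, **`exists_partner_of_v113`** (in a connected graph not made of (1.13)-vertices only,
  the line through a (1.13)-vertex ends at a vertex of another kind).
* `§7` counting: `vert113` / `vertNe113` / `legsNe113` (+ `card_vertNe113_add_card_vert113`, `card_legsNe113`,
  `card_legsNe113_le` (≤ (n̄+4)·#non-(1.13) vertices), **`card_vert113_le_card_legsNe113`** (injection of the (1.13)-vertices
  into the legs of the other vertices)), `vertexOrder` / `sum_vertexOrder` (= `(ordersCt G ct).1 + (ordersCt G ct).2`) /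
  `one_le_vertexOrder` / `card_vertNe113_le_order`; **`nV_le_of_isConnected`**: a connected `G`, not all of kind (1.13),
  with counterterm orders `ct` positive at every vertex (1.7), has `G.nV ≤ (n̄ + 5)·((ordersCt G ct).1 + (ordersCt G ct).2)`;
  `nV_le_of_isConnected_no17` (no vertex (1.7): `G.nV ≤ (n̄ + 5)·(d_s(G) + d_v(G))`); hence
  **`finite_connected_order_le_no17`** and **`finite_connected_ordersCt_le`**: at each total order `≤ N` the connected graphs
  (with the said provisos) form a FINITE set, and `finite_image_connected_ordersCt_le` (finitely many classes of them in any quotient).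
* `§8` the provisos are needed — a WITNESS: `chain17 n̄ m`, the bare (1.7)-chain on `m + 2` vertices (`chain17Other`, `leg17`,
  `chain17_isConnected`, `chain17_orders` = (0, 0), `chain17_nV_kind`), whence **`not_finite_connected_orders_zero`**:
  without counting the counterterm orders the connected graphs of orders (0, 0) not made of (1.13)-vertices are already
  infinitely many.

HONEST SCOPE.  (i) The unconditional finiteness (§2–§3) is at fixed (or bounded) NUMBER OF VERTICES.  At fixed COUPLING
ORDER the vertex count is bounded only under the provisos of `nV_le_of_isConnected`, and each is needed on p18's carrier: a
DISCONNECTED graph may carry any number of order-zero components; the bare vertex (1.7) has d_s = d_v = 0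
(`B3ClassOrders420.orders_v17_bare`), so (1.7)-chains of any length have orders (0, 0) unless the counterterm orders `ct` are
counted (print: δm² starts at order two, p. 417 — the hypothesis `1 ≤ (ct i).1 + (ct i).2` is weaker; the witness of `§8`
makes this a kernel fact); and two operator
vertices (1.13) joined by one line are a connected graph of order (0, 0) (excluded by «not all of kind (1.13)»; print pairs
(1.13) with (1.14)/(1.15) in (1.18)).  The constant (n̄ + 5) is crude (four φ′-legs + n̄ A′-legs + the vertex itself); no
sharp count is claimed.  (ii) No isomorphism class is constructed and no symmetry factor is defined (print leaves the
combinatoric factors implicit); the class-level statements are about the image in an ARBITRARY quotient.  Isomorphisms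
themselves (`B3GraphIso.GraphIso`), their finiteness, the automorphism group, the relabelling action and orbit–stabilizer are
the sibling file `B3GraphRelabelling` (p32 gen 45).  (iii) Nothing analytic; no amplitude is attached.
-/

namespace Literature.MathematicalPhysics.QuantumFieldTheory.Balaban1983to89.B3GraphFiniteOrder

open Relation Finset B3Prop1 B3Cor23Concrete B3GraphGlueLegs B3OnePIChainGlue B3OnePIGraphs B3ClassOrders420

variable {nbar : ℕ}

/-! ## §1 The admissible catalogue (1.6)–(1.15) at order n̄ is finite -/

/-- An enumeration of the catalogue (1.6)–(1.15) by a tag `t < 9` and the two printed integer parameters («(ours)», plumbing for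
`finite_admissible`): tags 0–8 ↦ (1.6), (1.7), (1.8), (1.9), (1.10), (1.11), (1.13), (1.14), (1.15); for the R-vertices the
second parameter is the fixed n̄. [cite: Balaban1983Higgs3, (1.6)–(1.15) pp.413–414] -/
def catalogueOf (nbar : ℕ) : ℕ → ℕ → ℕ → VertexKind
  | 0, _, _ => .v16
  | 1, _, _ => .v17
  | 2, n, n' => .v18 n n'
  | 3, n, _ => .v19 n nbar
  | 4, n, n' => .v110 n n'
  | 5, n, _ => .v111 n nbar
  | 6, _, _ => .v113
  | 7, n, n' => .v114 n n'
  | _, n, _ => .v115 n nbar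

/-- kernel: every ADMISSIBLE vertex of the catalogue at order n̄ (the printed side conditions *"n, n′ ≤ n̄"*, *"n ≤ n̄"* of
(1.8)–(1.15)) is enumerated by a tag `< 9` and two parameters `≤ n̄`. [cite: Balaban1983Higgs3, (1.6)–(1.15) pp.413–414] -/
theorem exists_catalogueOf_eq {v : VertexKind} (hv : v.Admissible nbar) :
    ∃ p : Fin 9 × Fin (nbar + 1) × Fin (nbar + 1), catalogueOf nbar p.1 p.2.1 p.2.2 = v := by
  cases v with
  | v16 => exact ⟨(⟨0, by omega⟩, 0, 0), rfl⟩
  | v17 => exact ⟨(⟨1, by omega⟩, 0, 0), rfl⟩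
  | v18 n n' =>
    obtain ⟨h1, h2, -⟩ := hv
    exact ⟨(⟨2, by omega⟩, ⟨n, by omega⟩, ⟨n', by omega⟩), rfl⟩
  | v19 n nb =>
    obtain ⟨rfl, h2⟩ := hv
    exact ⟨(⟨3, by omega⟩, ⟨n, by omega⟩, 0), rfl⟩
  | v110 n n' =>
    obtain ⟨-, h1, h2, -⟩ := hv
    exact ⟨(⟨4, by omega⟩, ⟨n, by omega⟩, ⟨n', by omega⟩), rfl⟩
  | v111 n nb =>
    obtain ⟨rfl, h2⟩ := hv
    exact ⟨(⟨5, by omega⟩, ⟨n, by omega⟩, 0), rfl⟩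
  | v113 => exact ⟨(⟨6, by omega⟩, 0, 0), rfl⟩
  | v114 n n' =>
    obtain ⟨h1, h2, -⟩ := hv
    exact ⟨(⟨7, by omega⟩, ⟨n, by omega⟩, ⟨n', by omega⟩), rfl⟩
  | v115 n nb =>
    obtain ⟨rfl, h2⟩ := hv
    exact ⟨(⟨8, by omega⟩, ⟨n, by omega⟩, 0), rfl⟩

/-- **The admissible catalogue at order n̄ is a finite set of vertex kinds** — the printed side conditions bound every
integer parameter by n̄. [cite: Balaban1983Higgs3, (1.6)–(1.15) pp.413–414] -/
theorem finite_admissible (nbar : ℕ) : Set.Finite {v : VertexKind | v.Admissible nbar} :=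
  (Set.finite_range fun p : Fin 9 × Fin (nbar + 1) × Fin (nbar + 1) => catalogueOf nbar p.1 p.2.1 p.2.2).subset
    fun _ hv => exists_catalogueOf_eq hv

/-- The admissible vertex kinds at order n̄ as a type («(ours)», plumbing). [cite: Balaban1983Higgs3, (1.6)–(1.15) pp.413–414] -/
abbrev AdmKind (nbar : ℕ) : Type := {v : VertexKind // v.Admissible nbar}

/-- kernel: finitely many admissible vertex kinds at order n̄. [cite: Balaban1983Higgs3, (1.6)–(1.15) pp.413–414] -/
instance finite_admKind (nbar : ℕ) : Finite (AdmKind nbar) :=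
  (finite_admissible nbar).to_subtype

/-! ## §2 Finitely many graphs of the model with a given number of vertices -/

/-- The raw data of a graph on `V` vertices («(ours)», plumbing): an admissible kind for every vertex and an «other endpoint»
map on the legs — the two data fields of p18's `Graph` (p. 415: vertices from the catalogue, internal lines as the pairing of
legs). [cite: Balaban1983Higgs3, p.415] -/
abbrev RawGraph (nbar V : ℕ) : Type :=
  Σ k : Fin V → AdmKind nbar, (Leg (fun i => (k i).1) → Option (Leg (fun i => (k i).1)))

/-- kernel: finitely many raw data on `V` vertices. [cite: Balaban1983Higgs3, p.415] -/
instance finite_rawGraph (nbar V : ℕ) : Finite (RawGraph nbar V) := by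
  infer_instance

/-- The printed conditions on the raw data (p. 415: *"There is at least one internal line, and every internal line has a
vertex at each endpoint"*; p. 414: scalar legs pair with scalar legs, vector legs with vector legs) — the four proof fields of
p18's `Graph`. [cite: Balaban1983Higgs3, p.415] -/
def RawGraph.Valid {V : ℕ} (r : RawGraph nbar V) : Prop :=
  (∀ x y, r.2 x = some y → y ≠ x) ∧ (∀ x y, r.2 x = some y → r.2 y = some x) ∧
    (∀ x y, r.2 x = some y → x.2.isLeft = y.2.isLeft) ∧ (∃ x, (r.2 x).isSome)

/-- The graph of valid raw data («(ours)», plumbing). [cite: Balaban1983Higgs3, p.415] -/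
def RawGraph.toGraph {V : ℕ} (r : {r : RawGraph nbar V // r.Valid}) : {G : Graph nbar // G.nV = V} :=
  ⟨⟨V, fun i => (r.1.1 i).1, fun i => (r.1.1 i).2, r.1.2, r.2.1, r.2.2.1, r.2.2.2.1, r.2.2.2.2⟩, rfl⟩

/-- kernel: every graph on `V` vertices arises from valid raw data. [cite: Balaban1983Higgs3, p.415] -/
theorem RawGraph.toGraph_surjective (V : ℕ) : Function.Surjective (RawGraph.toGraph (nbar := nbar) (V := V)) := by
  rintro ⟨G, hG⟩
  subst hG
  refine ⟨⟨⟨fun i => ⟨G.kind i, G.adm i⟩, G.other⟩, G.other_ne, G.other_symm, G.other_isLeft, G.exists_line⟩, ?_⟩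
  cases G
  rfl

/-- **The model has finitely many graphs with a given number of vertices** (at order n̄): the vertex kinds range over the
finite admissible catalogue and the lines over the finitely many pairings of the finitely many legs.  This is the finiteness
behind every sum over graphs with a bounded number of vertices being a finite sum (for a bound in terms of the COUPLING ORDER
see `§7`), and behind print's *"combinatoric factors … are a part of the graphical description"* (p. 416).
[cite: Balaban1983Higgs3, (1.17) p.415] -/
instance finite_graph_nV_eq (nbar V : ℕ) : Finite {G : Graph nbar // G.nV = V} :=
  Finite.of_surjective _ (RawGraph.toGraph_surjective V)

/-- kernel: set form — the graphs with exactly `V` vertices form a finite set. [cite: Balaban1983Higgs3, (1.17) p.415] -/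
theorem finite_setOf_nV_eq (nbar V : ℕ) : Set.Finite {G : Graph nbar | G.nV = V} :=
  Set.finite_coe_iff.mp (finite_graph_nV_eq nbar V)

/-- **The graphs with at most `V` vertices form a finite set.** [cite: Balaban1983Higgs3, (1.17) p.415] -/
theorem finite_setOf_nV_le (nbar V : ℕ) : Set.Finite {G : Graph nbar | G.nV ≤ V} := by
  refine (Set.finite_iUnion fun W : Fin (V + 1) => finite_setOf_nV_eq nbar W).subset fun G hG => ?_
  exact Set.mem_iUnion.mpr ⟨⟨G.nV, Nat.lt_succ_of_le hG⟩, rfl⟩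

/-- kernel: type form of `finite_setOf_nV_le`. [cite: Balaban1983Higgs3, (1.17) p.415] -/
instance finite_graph_nV_le (nbar V : ℕ) : Finite {G : Graph nbar // G.nV ≤ V} :=
  (finite_setOf_nV_le nbar V).to_subtype

/-- **Finitely many classes at bounded order, in any quotient**: the image of the graphs with at most `V` vertices under ANY
map (in particular under the class map of any identification of graphs, e.g. up to isomorphism — p. 415 takes graphs *"in the
usual sense"*) is finite. [cite: Balaban1983Higgs3, (1.17) p.415] -/
theorem finite_image_nV_le {α : Type*} (f : Graph nbar → α) (V : ℕ) : Set.Finite (f '' {G : Graph nbar | G.nV ≤ V}) :=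
  (finite_setOf_nV_le nbar V).image f

/-- kernel: quotient form — for every setoid on the graphs of the model, the classes met by graphs with at most `V` vertices
form a finite set. [cite: Balaban1983Higgs3, (1.17) p.415] -/
theorem finite_classes_nV_le (s : Setoid (Graph nbar)) (V : ℕ) :
    Set.Finite {c : Quotient s | ∃ G : Graph nbar, G.nV ≤ V ∧ Quotient.mk s G = c} := by
  convert finite_image_nV_le (Quotient.mk s) V using 1
  ext c
  simp

/-! ## §3 Finitely many two-leg insertions with a given number of vertices -/

/-- The raw data of a two-leg insertion on `V` vertices («(ours)», plumbing): a graph on `V` vertices with two marked legs.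
[cite: Balaban1983Higgs3, (1.21) p.416] -/
abbrev RawTwoLeg (nbar V : ℕ) : Type :=
  Σ G : {G : Graph nbar // G.nV = V}, Leg G.1.kind × Leg G.1.kind

/-- kernel: finitely many raw two-leg data on `V` vertices. [cite: Balaban1983Higgs3, (1.21) p.416] -/
instance finite_rawTwoLeg (nbar V : ℕ) : Finite (RawTwoLeg nbar V) := by
  infer_instance

/-- The conditions of p37's `TwoLegGraph` on the raw data: both marked legs external, distinct, of scalar type.
[cite: Balaban1983Higgs3, (1.21) p.416] -/
def RawTwoLeg.Valid {V : ℕ} (r : RawTwoLeg nbar V) : Prop :=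
  r.1.1.other r.2.1 = none ∧ r.1.1.other r.2.2 = none ∧ r.2.1 ≠ r.2.2 ∧ r.2.1.2.isLeft = true ∧ r.2.2.2.isLeft = true

/-- The two-leg insertion of valid raw data («(ours)», plumbing). [cite: Balaban1983Higgs3, (1.21) p.416] -/
def RawTwoLeg.toTwoLeg {V : ℕ} (r : {r : RawTwoLeg nbar V // r.Valid}) : {T : TwoLegGraph nbar // T.G.nV = V} :=
  ⟨⟨r.1.1.1, r.1.2.1, r.1.2.2, r.2.1, r.2.2.1, r.2.2.2.1, r.2.2.2.2.1, r.2.2.2.2.2⟩, r.1.1.2⟩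

/-- kernel: every two-leg insertion on `V` vertices arises from valid raw data. [cite: Balaban1983Higgs3, (1.21) p.416] -/
theorem RawTwoLeg.toTwoLeg_surjective (V : ℕ) : Function.Surjective (RawTwoLeg.toTwoLeg (nbar := nbar) (V := V)) := by
  rintro ⟨T, hT⟩
  refine ⟨⟨⟨⟨T.G, hT⟩, T.legIn, T.legOut⟩, T.in_ext, T.out_ext, T.in_ne_out, T.in_scalar, T.out_scalar⟩, ?_⟩
  cases T
  rfl

/-- **Finitely many two-leg insertions (letters and chains of (1.21)) with a given number of vertices.**
[cite: Balaban1983Higgs3, (1.21) p.416] -/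
instance finite_twoLeg_nV_eq (nbar V : ℕ) : Finite {T : TwoLegGraph nbar // T.G.nV = V} :=
  Finite.of_surjective _ (RawTwoLeg.toTwoLeg_surjective V)

/-- kernel: set form. [cite: Balaban1983Higgs3, (1.21) p.416] -/
theorem finite_setOf_twoLeg_nV_eq (nbar V : ℕ) : Set.Finite {T : TwoLegGraph nbar | T.G.nV = V} :=
  Set.finite_coe_iff.mp (finite_twoLeg_nV_eq nbar V)

/-- **The two-leg insertions with at most `V` vertices form a finite set.** [cite: Balaban1983Higgs3, (1.21) p.416] -/
theorem finite_setOf_twoLeg_nV_le (nbar V : ℕ) : Set.Finite {T : TwoLegGraph nbar | T.G.nV ≤ V} := by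
  refine (Set.finite_iUnion fun W : Fin (V + 1) => finite_setOf_twoLeg_nV_eq nbar W).subset fun T hT => ?_
  exact Set.mem_iUnion.mpr ⟨⟨T.G.nV, Nat.lt_succ_of_le hT⟩, rfl⟩

/-- kernel: type form of `finite_setOf_twoLeg_nV_le`. [cite: Balaban1983Higgs3, (1.21) p.416] -/
instance finite_twoLeg_nV_le (nbar V : ℕ) : Finite {T : TwoLegGraph nbar // T.G.nV ≤ V} :=
  (finite_setOf_twoLeg_nV_le nbar V).to_subtype

/-- **Finitely many classes of two-leg insertions at bounded order, in any quotient** (e.g. the letters of (1.21) up to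
isomorphism). [cite: Balaban1983Higgs3, (1.21) p.416] -/
theorem finite_image_twoLeg_nV_le {α : Type*} (f : TwoLegGraph nbar → α) (V : ℕ) :
    Set.Finite (f '' {T : TwoLegGraph nbar | T.G.nV ≤ V}) :=
  (finite_setOf_twoLeg_nV_le nbar V).image f

/-- kernel: quotient form for two-leg insertions. [cite: Balaban1983Higgs3, (1.21) p.416] -/
theorem finite_twoLeg_classes_nV_le (s : Setoid (TwoLegGraph nbar)) (V : ℕ) :
    Set.Finite {c : Quotient s | ∃ T : TwoLegGraph nbar, T.G.nV ≤ V ∧ Quotient.mk s T = c} := by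
  convert finite_image_twoLeg_nV_le (Quotient.mk s) V using 1
  ext c
  simp

/-! ## §4 The number of legs at bounded order -/

/-- kernel: an admissible vertex at order n̄ has at most n̄ legs of A′ (the printed *"n ≤ n̄"*).
[cite: Balaban1983Higgs3, (1.8)–(1.15) pp.413–414] -/
theorem vectorLegs_le_of_admissible {v : VertexKind} (hv : v.Admissible nbar) : v.vectorLegs ≤ nbar := by
  cases v <;> simp [VertexKind.vectorLegs, VertexKind.Admissible] at * <;> omega

/-- **A graph of the model with `V` vertices has at most `(n̄ + 4)·V` legs** (hence at most that many lines and external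
legs): the leg count of the catalogue is bounded at order n̄. [cite: Balaban1983Higgs3, (1.17) p.415] -/
theorem card_leg_le (G : Graph nbar) : Fintype.card (Leg G.kind) ≤ (nbar + 4) * G.nV := by
  rw [Fintype.card_sigma]
  calc ∑ i, Fintype.card (Fin (G.kind i).scalarLegs ⊕ Fin (G.kind i).vectorLegs)
      ≤ ∑ _i : Fin G.nV, (nbar + 4) := Finset.sum_le_sum fun i _ => by
        rw [Fintype.card_sum, Fintype.card_fin, Fintype.card_fin]
        have h1 := B3OddVectorLoopsVanish.scalarLegs_le_four (G.kind i)
        have h2 := vectorLegs_le_of_admissible (G.adm i)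
        omega
    _ = (nbar + 4) * G.nV := by simp [mul_comm]

/-! ## §5 Every vertex of the catalogue except (1.7) and (1.13) carries a coupling constant -/

/-- kernel: **an admissible vertex other than the mass-renormalization vertex (1.7) and the operator (1.13) has positive
order d_s + d_v** — (1.6) carries λ; (1.8)–(1.11), (1.14), (1.15) carry e^{n+n′} with n + n′ ≥ 1 (the printed side
conditions), e^{n+n̄+1} for the R-vertices. [cite: Balaban1983Higgs3, (1.6)–(1.15) pp.413–414, p.420] -/
theorem one_le_ds_add_dv {v : VertexKind} (hv : v.Admissible nbar) (h17 : v ≠ .v17) (h113 : v ≠ .v113) :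
    1 ≤ v.ds + v.dv := by
  cases v <;> simp [VertexKind.ds, VertexKind.dv, VertexKind.Admissible] at * <;> omega

/-- kernel: the operator vertex (1.13) has exactly one leg, a φ′-leg. [cite: Balaban1983Higgs3, (1.13) p.414] -/
theorem legs_v113 : VertexKind.v113.scalarLegs = 1 ∧ VertexKind.v113.vectorLegs = 0 := ⟨rfl, rfl⟩

/-! ## §6 The legs of a vertex (1.13) in a connected graph -/

section V113

variable (G : Graph nbar)

/-- kernel: a vertex of kind (1.13) has at most one leg (its leg fibre is a subsingleton). [cite: Balaban1983Higgs3, (1.13) p.414] -/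
theorem subsingleton_fibre_of_v113 {i : Fin G.nV} (h : G.kind i = .v113) :
    Subsingleton (Fin (G.kind i).scalarLegs ⊕ Fin (G.kind i).vectorLegs) := by
  refine Fintype.card_le_one_iff_subsingleton.mp ?_
  rw [Fintype.card_sum, Fintype.card_fin, Fintype.card_fin, h]
  decide

/-- kernel: two legs sitting at the same vertex of kind (1.13) are equal. [cite: Balaban1983Higgs3, (1.13) p.414] -/
theorem leg_eq_of_v113 {i : Fin G.nV} (h : G.kind i = .v113) {x x' : Leg G.kind} (hx : x.1 = i) (hx' : x'.1 = i) :
    x = x' := by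
  obtain ⟨a, s⟩ := x
  obtain ⟨a', s'⟩ := x'
  dsimp only at hx hx'
  subst hx
  subst hx'
  have := subsingleton_fibre_of_v113 G h
  rw [Subsingleton.elim s s']

/-- The leg of a vertex of kind (1.13) (its φ′-leg). [cite: Balaban1983Higgs3, (1.13) p.414] -/
def legAt113 (i : Fin G.nV) (h : G.kind i = .v113) : Leg G.kind :=
  ⟨i, .inl ⟨0, by rw [h]; decide⟩⟩

/-- kernel: the leg of a (1.13)-vertex sits at that vertex. [cite: Balaban1983Higgs3, (1.13) p.414] -/
@[simp] theorem fst_legAt113 (i : Fin G.nV) (h : G.kind i = .v113) : (legAt113 G i h).1 = i := rfl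

/-- kernel: every leg at a (1.13)-vertex is its leg. [cite: Balaban1983Higgs3, (1.13) p.414] -/
theorem eq_legAt113 {i : Fin G.nV} (h : G.kind i = .v113) {x : Leg G.kind} (hx : x.1 = i) : x = legAt113 G i h :=
  leg_eq_of_v113 G h hx rfl

/-- kernel: an adjacency out of a (1.13)-vertex runs along its unique leg: if `Adj G i l` then the line through the leg of
`i` ends at `l`. [cite: Balaban1983Higgs3, (1.13) p.414, p.415] -/
theorem adj_v113 {i l : Fin G.nV} (h : G.kind i = .v113) (hadj : Adj G i l) :
    ∃ y, G.other (legAt113 G i h) = some y ∧ y.1 = l := by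
  obtain ⟨x, y, hxy, hx, hy⟩ := adj_iff.mp hadj
  exact ⟨y, by rw [← eq_legAt113 G h hx]; exact hxy, hy⟩

/-- kernel: **two (1.13)-vertices joined by a line form a whole connected component** — every vertex reachable from one of
them is one of the two. [cite: Balaban1983Higgs3, (1.13) p.414, p.415] -/
theorem eq_or_eq_of_reachable_pair113 {i j : Fin G.nV} (hi : G.kind i = .v113) (hj : G.kind j = .v113)
    {y : Leg G.kind} (hy : G.other (legAt113 G i hi) = some y) (hyj : y.1 = j) :
    ∀ {k : Fin G.nV}, ReflTransGen (Adj G) i k → k = i ∨ k = j := by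
  have hyx : G.other (legAt113 G j hj) = some (legAt113 G i hi) := by
    rw [← eq_legAt113 G hj hyj]
    exact G.other_symm _ _ hy
  intro k hk
  induction hk with
  | refl => exact Or.inl rfl
  | tail _ hkl ih =>
    rcases ih with rfl | rfl
    · obtain ⟨y', hy', rfl⟩ := adj_v113 G hi hkl
      rw [hy] at hy'
      cases hy'
      exact Or.inr hyj
    · obtain ⟨y', hy', rfl⟩ := adj_v113 G hj hkl
      rw [hyx] at hy'
      cases hy'
      exact Or.inl rfl

/-- kernel: in a connected graph with a second vertex, the leg of a (1.13)-vertex lies on an internal line.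
[cite: Balaban1983Higgs3, (1.13) p.414, p.415] -/
theorem isSome_other_legAt113 (hG : IsConnected G) {i j : Fin G.nV} (hij : i ≠ j) (h : G.kind i = .v113) :
    (G.other (legAt113 G i h)).isSome := by
  rcases (hG i j).cases_head with hji | ⟨k, hik, -⟩
  · exact absurd hji hij
  · obtain ⟨y, hy, -⟩ := adj_v113 G h hik
    simp [hy]

/-- kernel: **in a connected graph that is not made of (1.13)-vertices only, the line through the leg of a (1.13)-vertex
ends at a vertex of another kind** (else the two (1.13)-vertices would be a whole component). [cite: Balaban1983Higgs3, (1.13) p.414, p.415] -/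
theorem exists_partner_of_v113 (hG : IsConnected G) (hne : ∃ j, G.kind j ≠ .v113) {i : Fin G.nV} (h : G.kind i = .v113) :
    ∃ y, G.other (legAt113 G i h) = some y ∧ G.kind y.1 ≠ .v113 := by
  obtain ⟨j, hj⟩ := hne
  have hij : i ≠ j := fun hij => hj (hij ▸ h)
  obtain ⟨y, hy⟩ := Option.isSome_iff_exists.mp (isSome_other_legAt113 G hG hij h)
  refine ⟨y, hy, fun hy113 => ?_⟩
  rcases eq_or_eq_of_reachable_pair113 G h hy113 hy rfl (hG i j) with rfl | rfl
  · exact hij rfl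
  · exact hj hy113

end V113

/-! ## §7 The number of vertices of a connected graph at fixed order; finitely many connected graphs per order -/

section Bound

variable (G : Graph nbar)

/-- The vertices of kind (1.13) of `G` («(ours)», bookkeeping). [cite: Balaban1983Higgs3, (1.13) p.414] -/
def vert113 : Finset (Fin G.nV) := univ.filter fun i => G.kind i = .v113

/-- The vertices of `G` of a kind other than (1.13) («(ours)», bookkeeping). [cite: Balaban1983Higgs3, (1.13) p.414] -/
def vertNe113 : Finset (Fin G.nV) := univ.filter fun i => G.kind i ≠ .v113

/-- kernel: every vertex is of kind (1.13) or not. [cite: Balaban1983Higgs3, p.415] -/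
theorem card_vertNe113_add_card_vert113 : (vertNe113 G).card + (vert113 G).card = G.nV := by
  unfold vertNe113 vert113
  have h := Finset.card_filter_add_card_filter_not (s := (univ : Finset (Fin G.nV))) (fun i => G.kind i ≠ .v113)
  simp only [not_not, card_univ, Fintype.card_fin] at h
  exact h

/-- The legs of `G` sitting at vertices of a kind other than (1.13) («(ours)», bookkeeping). [cite: Balaban1983Higgs3, p.415] -/
def legsNe113 : Finset (Leg G.kind) := univ.filter fun x => G.kind x.1 ≠ .v113

/-- kernel: the legs at the non-(1.13) vertices, counted vertex by vertex. [cite: Balaban1983Higgs3, p.415] -/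
theorem card_legsNe113 : (legsNe113 G).card = ∑ i ∈ vertNe113 G, ((G.kind i).scalarLegs + (G.kind i).vectorLegs) := by
  unfold legsNe113 vertNe113
  have h : (univ.filter fun x : Leg G.kind => G.kind x.1 ≠ .v113) =
      (univ.filter fun i : Fin G.nV => G.kind i ≠ .v113).sigma fun _ => univ := by
    ext x
    simp
  rw [h, card_sigma]
  refine sum_congr rfl fun i _ => ?_
  rw [card_univ, Fintype.card_sum, Fintype.card_fin, Fintype.card_fin]

/-- kernel: **the legs at the non-(1.13) vertices number at most `(n̄ + 4)·#{non-(1.13) vertices}`** (at most four φ′-legs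
and n ≤ n̄ A′-legs per admissible vertex). [cite: Balaban1983Higgs3, (1.6)–(1.15) pp.413–414] -/
theorem card_legsNe113_le : (legsNe113 G).card ≤ (nbar + 4) * (vertNe113 G).card := by
  rw [card_legsNe113, mul_comm, Finset.card_eq_sum_ones, Finset.sum_mul]
  refine sum_le_sum fun i _ => ?_
  have h1 := B3OddVectorLoopsVanish.scalarLegs_le_four (G.kind i)
  have h2 := vectorLegs_le_of_admissible (G.adm i)
  omega

/-- kernel: **in a connected graph not made of (1.13)-vertices only, the (1.13)-vertices are at most as many as the legs at
the other vertices** — the line through the leg of a (1.13)-vertex ends at a leg of a vertex of another kind, injectively.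
[cite: Balaban1983Higgs3, (1.13) p.414, p.415] -/
theorem card_vert113_le_card_legsNe113 (hG : IsConnected G) (hne : ∃ j, G.kind j ≠ .v113) :
    (vert113 G).card ≤ (legsNe113 G).card := by
  classical
  obtain ⟨x₀, -⟩ := G.exists_line
  -- the partner leg of a (1.13)-vertex (the junk value `x₀` elsewhere)
  let f : Fin G.nV → Leg G.kind := fun i =>
    if h : G.kind i = .v113 then (G.other (legAt113 G i h)).getD x₀ else x₀
  have hf : ∀ i (h : G.kind i = .v113), G.other (legAt113 G i h) = some (f i) ∧ G.kind (f i).1 ≠ .v113 := by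
    intro i h
    obtain ⟨y, hy, hy'⟩ := exists_partner_of_v113 G hG hne h
    have : f i = y := by simp only [f, dif_pos h, hy, Option.getD_some]
    rw [this]
    exact ⟨hy, hy'⟩
  refine Finset.card_le_card_of_injOn f (fun i hi => ?_) (fun i hi i' hi' hii' => ?_)
  · have h := (Finset.mem_filter.mp hi).2
    exact Finset.mem_filter.mpr ⟨mem_univ _, (hf i h).2⟩
  · have h := (Finset.mem_filter.mp (Finset.mem_coe.mp hi)).2
    have h' := (Finset.mem_filter.mp (Finset.mem_coe.mp hi')).2
    have hs := G.other_symm _ _ (hf i h).1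
    have hs' := G.other_symm _ _ (hf i' h').1
    rw [hii'] at hs
    rw [hs] at hs'
    have hl : legAt113 G i h = legAt113 G i' h' := Option.some_injective _ hs'
    exact congrArg Sigma.fst hl

/-- The coupling order carried by the vertex `i` with the counterterm orders `ct` («(ours)», bookkeeping): d_s + d_v of its
kind plus the two orders of its counterterm (p33's `B3ClassOrders420.ordersCt` reading: a vertex (1.7) carries the orders
of its counterterm's graph). [cite: Balaban1983Higgs3, p.420] -/
def vertexOrder (ct : Fin G.nV → ℕ × ℕ) (i : Fin G.nV) : ℕ := (G.kind i).ds + (G.kind i).dv + ((ct i).1 + (ct i).2)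

/-- kernel: the total of the vertex orders is the total order `(ordersCt G ct).1 + (ordersCt G ct).2`.
[cite: Balaban1983Higgs3, p.420] -/
theorem sum_vertexOrder (ct : Fin G.nV → ℕ × ℕ) :
    ∑ i, vertexOrder G ct i = (ordersCt G ct).1 + (ordersCt G ct).2 := by
  unfold vertexOrder ordersCt
  rw [← Finset.sum_add_distrib]
  refine Finset.sum_congr rfl fun i _ => ?_
  ring

/-- kernel: **every non-(1.13) vertex carries a positive order once the mass-renormalization vertices carry counterterms of
positive order** (print: δm² = Σ_{2≤α+2β≤4} e^αλ^β δm²_{(α,β)}, p. 417). [cite: Balaban1983Higgs3, p.417, p.420] -/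
theorem one_le_vertexOrder (ct : Fin G.nV → ℕ × ℕ) (hct : ∀ i, G.kind i = .v17 → 1 ≤ (ct i).1 + (ct i).2)
    {i : Fin G.nV} (hi : G.kind i ≠ .v113) : 1 ≤ vertexOrder G ct i := by
  unfold vertexOrder
  by_cases h17 : G.kind i = .v17
  · have := hct i h17
    omega
  · have := one_le_ds_add_dv (G.adm i) h17 hi
    omega

/-- kernel: hence the non-(1.13) vertices are at most as many as the total order. [cite: Balaban1983Higgs3, p.420] -/
theorem card_vertNe113_le_order (ct : Fin G.nV → ℕ × ℕ) (hct : ∀ i, G.kind i = .v17 → 1 ≤ (ct i).1 + (ct i).2) :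
    (vertNe113 G).card ≤ (ordersCt G ct).1 + (ordersCt G ct).2 := by
  rw [← sum_vertexOrder, Finset.card_eq_sum_ones]
  calc ∑ i ∈ vertNe113 G, 1 ≤ ∑ i ∈ vertNe113 G, vertexOrder G ct i :=
        sum_le_sum fun i hi => one_le_vertexOrder G ct hct (Finset.mem_filter.mp hi).2
    _ ≤ ∑ i, vertexOrder G ct i :=
        sum_le_sum_of_subset_of_nonneg (Finset.subset_univ _) fun _ _ _ => Nat.zero_le _

/-- **ORDER BOUND.**  A CONNECTED graph of the model that is not made of operator vertices (1.13) only, whose mass-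
renormalization vertices (1.7) carry counterterms of positive order, has at most `(n̄ + 5)·(d_s + d_v + counterterm orders)`
vertices — so at every fixed order (e^α λ^β with the counterterms' orders counted, as print counts them: δm² starts at order
2, p. 417) the connected graphs of the expansion have boundedly many vertices, hence (`finite_connected_ordersCt_le` below)
are finitely many.  KIND «(ours)»: print never states this; it is what makes each order of (1.17)–(1.22) a finite sum of graphs on p18's
carrier, where the bare vertex (1.7) and the operator (1.13) carry no coupling. [cite: Balaban1983Higgs3, (1.17) p.415, p.420] -/
theorem nV_le_of_isConnected (hG : IsConnected G) (hne : ∃ j, G.kind j ≠ .v113) (ct : Fin G.nV → ℕ × ℕ)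
    (hct : ∀ i, G.kind i = .v17 → 1 ≤ (ct i).1 + (ct i).2) :
    G.nV ≤ (nbar + 5) * ((ordersCt G ct).1 + (ordersCt G ct).2) := by
  have h1 := card_vertNe113_add_card_vert113 G
  have h2 := card_vert113_le_card_legsNe113 G hG hne
  have h3 := card_legsNe113_le G
  have h4 := card_vertNe113_le_order G ct hct
  calc G.nV = (vertNe113 G).card + (vert113 G).card := h1.symm
    _ ≤ (nbar + 5) * (vertNe113 G).card := by nlinarith
    _ ≤ (nbar + 5) * ((ordersCt G ct).1 + (ordersCt G ct).2) := Nat.mul_le_mul_left _ h4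

/-- kernel: the same bound with the plain orders (d_s(G), d_v(G)) of p. 420 for a connected graph WITHOUT mass-renormalization
vertices (then no counterterm bookkeeping is needed). [cite: Balaban1983Higgs3, p.420] -/
theorem nV_le_of_isConnected_no17 (hG : IsConnected G) (hne : ∃ j, G.kind j ≠ .v113) (h17 : ∀ i, G.kind i ≠ .v17) :
    G.nV ≤ (nbar + 5) * (dsG G + dvG G) := by
  have h := nV_le_of_isConnected G hG hne (fun _ => (0, 0)) (fun i hi => absurd hi (h17 i))
  rw [ordersCt_zero] at h
  exact h

end Bound


/-! ### Finitely many connected graphs at each order -/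

/-- **FINITELY MANY CONNECTED GRAPHS AT EACH ORDER (no mass-renormalization vertices).**  The connected graphs of the model
that are not made of operator vertices (1.13) only, have no vertex (1.7), and have total order d_s(G) + d_v(G) ≤ N form a
FINITE set. [cite: Balaban1983Higgs3, (1.17) p.415, p.420] -/
theorem finite_connected_order_le_no17 (nbar N : ℕ) :
    Set.Finite {G : Graph nbar | IsConnected G ∧ (∃ j, G.kind j ≠ .v113) ∧ (∀ i, G.kind i ≠ .v17) ∧ dsG G + dvG G ≤ N} :=
  (finite_setOf_nV_le nbar ((nbar + 5) * N)).subset fun G ⟨hG, hne, h17, hN⟩ =>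
    (nV_le_of_isConnected_no17 G hG hne h17).trans (Nat.mul_le_mul_left _ hN)

/-- **FINITELY MANY CONNECTED GRAPHS AT EACH ORDER, COUNTERTERMS COUNTED.**  The connected graphs of the model, not made of
(1.13)-vertices only, that admit counterterm orders `ct` of positive order at every vertex (1.7) with total order
`(ordersCt G ct).1 + (ordersCt G ct).2 ≤ N`, form a FINITE set. [cite: Balaban1983Higgs3, (1.17) p.415, p.417, p.420] -/
theorem finite_connected_ordersCt_le (nbar N : ℕ) :
    Set.Finite {G : Graph nbar | IsConnected G ∧ (∃ j, G.kind j ≠ .v113) ∧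
      ∃ ct : Fin G.nV → ℕ × ℕ, (∀ i, G.kind i = .v17 → 1 ≤ (ct i).1 + (ct i).2) ∧ (ordersCt G ct).1 + (ordersCt G ct).2 ≤ N} :=
  (finite_setOf_nV_le nbar ((nbar + 5) * N)).subset fun G ⟨hG, hne, ct, hct, hN⟩ =>
    (nV_le_of_isConnected G hG hne ct hct).trans (Nat.mul_le_mul_left _ hN)

/-- kernel: hence, in ANY identification of graphs (e.g. up to isomorphism), finitely many CLASSES of such connected graphs
are met at each order. [cite: Balaban1983Higgs3, (1.17) p.415, p.420] -/
theorem finite_image_connected_ordersCt_le {α : Type*} (f : Graph nbar → α) (N : ℕ) :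
    Set.Finite (f '' {G : Graph nbar | IsConnected G ∧ (∃ j, G.kind j ≠ .v113) ∧
      ∃ ct : Fin G.nV → ℕ × ℕ, (∀ i, G.kind i = .v17 → 1 ≤ (ct i).1 + (ct i).2) ∧ (ordersCt G ct).1 + (ordersCt G ct).2 ≤ N}) :=
  (finite_connected_ordersCt_le nbar N).image f

/-! ## §8 The provisos are needed: order-zero connected graphs of any size -/

section Witness

/-- the constant kind function of the bare (1.7)-chain («(ours)», plumbing). [cite: Balaban1983Higgs3, (1.7) p.413] -/
abbrev kind17 (m : ℕ) : Fin (m + 2) → VertexKind := fun _ => .v17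

/-- the leg in slot `s ∈ {0, 1}` of vertex `i` of the bare (1.7)-chain («(ours)», plumbing). [cite: Balaban1983Higgs3, (1.7) p.413] -/
def leg17 {m : ℕ} (i : Fin (m + 2)) (s : Fin 2) : Leg (kind17 m) := ⟨i, .inl s⟩

/-- the «other endpoint» map of the bare (1.7)-chain on `m + 2` vertices: the right leg (slot 1) of vertex `i` is joined to
the left leg (slot 0) of vertex `i + 1`; the left leg of vertex `0` and the right leg of the last vertex are external.
[cite: Balaban1983Higgs3, (1.7) p.413, (1.21) p.416] -/
def chain17Other (m : ℕ) : Leg (kind17 m) → Option (Leg (kind17 m))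
  | ⟨i, .inl j⟩ =>
    if (j : ℕ) = 1 then
      (if h : (i : ℕ) + 1 < m + 2 then some (leg17 ⟨i + 1, h⟩ 0) else none)
    else (if h : 0 < (i : ℕ) then some (leg17 ⟨i - 1, by omega⟩ 1) else none)
  | ⟨_, .inr j⟩ => j.elim0

/-- kernel: the line map of the chain, on the right legs. [cite: Balaban1983Higgs3, (1.7) p.413] -/
theorem chain17Other_right {m : ℕ} (i : Fin (m + 2)) :
    chain17Other m (leg17 i 1) = if h : (i : ℕ) + 1 < m + 2 then some (leg17 ⟨i + 1, h⟩ 0) else none := by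
  simp [chain17Other, leg17]

/-- kernel: the line map of the chain, on the left legs. [cite: Balaban1983Higgs3, (1.7) p.413] -/
theorem chain17Other_left {m : ℕ} (i : Fin (m + 2)) :
    chain17Other m (leg17 i 0) = if h : 0 < (i : ℕ) then some (leg17 ⟨i - 1, by omega⟩ 1) else none := by
  simp [chain17Other, leg17]

/-- kernel: every leg of the chain is a left or a right leg. [cite: Balaban1983Higgs3, (1.7) p.413] -/
theorem leg17_cases {m : ℕ} (x : Leg (kind17 m)) : x = leg17 x.1 0 ∨ x = leg17 x.1 1 := by
  obtain ⟨i, (j | j)⟩ := x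
  · rcases Fin.exists_fin_two.mp ⟨j, rfl⟩ with h | h
    · exact Or.inl (by rw [h]; rfl)
    · exact Or.inr (by rw [h]; rfl)
  · exact j.elim0

/-- kernel: `leg17` is injective in both arguments. [cite: Balaban1983Higgs3, (1.7) p.413] -/
theorem leg17_inj {m : ℕ} {i i' : Fin (m + 2)} {s s' : Fin 2} : (leg17 i s : Leg (kind17 m)) = leg17 i' s' ↔ i = i' ∧ s = s' := by
  constructor
  · intro h
    have h1 : i = i' := congrArg Sigma.fst h
    subst h1
    simp only [leg17, Sigma.mk.injEq, heq_eq_eq, Sum.inl.injEq, true_and] at h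
    exact ⟨rfl, h⟩
  · rintro ⟨rfl, rfl⟩
    rfl

/-- kernel: the line through the right leg of vertex `i − 1` ends at the left leg of vertex `i`. [cite: Balaban1983Higgs3, (1.7) p.413] -/
theorem chain17Other_pred {m : ℕ} (i : Fin (m + 2)) (h0 : 0 < (i : ℕ)) :
    chain17Other m (leg17 ⟨(i : ℕ) - 1, by omega⟩ 1) = some (leg17 i 0) :=
  (chain17Other_right _).trans ((dif_pos (show (i : ℕ) - 1 + 1 < m + 2 by omega)).trans
    (congrArg some (leg17_inj.mpr ⟨Fin.ext (show (i : ℕ) - 1 + 1 = i by omega), rfl⟩)))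

/-- kernel: the line through the left leg of vertex `i + 1` ends at the right leg of vertex `i`. [cite: Balaban1983Higgs3, (1.7) p.413] -/
theorem chain17Other_succ {m : ℕ} (i : Fin (m + 2)) (h0 : (i : ℕ) + 1 < m + 2) :
    chain17Other m (leg17 ⟨(i : ℕ) + 1, h0⟩ 0) = some (leg17 i 1) :=
  (chain17Other_left _).trans ((dif_pos (show 0 < (i : ℕ) + 1 by omega)).trans
    (congrArg some (leg17_inj.mpr ⟨Fin.ext (show (i : ℕ) + 1 - 1 = i by omega), rfl⟩)))

/-- **The bare (1.7)-chain on `m + 2` vertices** («(ours)», a witness): `m + 2` mass-renormalization vertices in a row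
joined by `m + 1` scalar lines, two external φ′-legs — a term of (1.21) all of whose letters are `−δm²`, read on p18's
carrier with the bare vertex (1.7) (no counterterm orders attached). [cite: Balaban1983Higgs3, (1.7) p.413, (1.21) p.416] -/
def chain17 (nbar m : ℕ) : Graph nbar where
  nV := m + 2
  kind := kind17 m
  adm _ := trivial
  other := chain17Other m
  other_ne x y h := by
    rcases leg17_cases x with hx | hx <;> rw [hx] at h ⊢
    · rw [chain17Other_left] at h
      split_ifs at h with h0
      cases h
      simp [leg17_inj]
    · rw [chain17Other_right] at h
      split_ifs at h with h0
      cases h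
      simp [leg17_inj, Fin.ext_iff]
  other_symm x y h := by
    rcases leg17_cases x with hx | hx <;> rw [hx] at h ⊢
    · rw [chain17Other_left] at h
      split_ifs at h with h0
      cases h
      exact chain17Other_pred _ h0
    · rw [chain17Other_right] at h
      split_ifs at h with h0
      cases h
      exact chain17Other_succ _ h0
  other_isLeft x y h := by
    obtain ⟨i, (j | j)⟩ := x
    · obtain ⟨i', (j' | j')⟩ := y
      · rfl
      · exact j'.elim0
    · exact j.elim0
  exists_line := ⟨leg17 ⟨0, by omega⟩ 1, by rw [chain17Other_right, dif_pos (by simp)]; rfl⟩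

/-- kernel: the data of the chain, unfolded. [cite: Balaban1983Higgs3, (1.7) p.413] -/
theorem chain17_nV (nbar m : ℕ) : (chain17 nbar m).nV = m + 2 := rfl

/-- kernel: the «other endpoint» map of the chain, unfolded. [cite: Balaban1983Higgs3, (1.7) p.413] -/
theorem chain17_other (nbar m : ℕ) : (chain17 nbar m).other = chain17Other m := rfl

/-- kernel: consecutive vertices of the chain are adjacent. [cite: Balaban1983Higgs3, (1.7) p.413] -/
theorem chain17_adj_succ (nbar m : ℕ) (k : ℕ) (hk : k + 1 < m + 2) :
    Adj (chain17 nbar m) (⟨k, by omega⟩ : Fin (m + 2)) (⟨k + 1, hk⟩ : Fin (m + 2)) :=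
  adj_iff.mpr ⟨leg17 ⟨k, by omega⟩ 1, leg17 ⟨k + 1, hk⟩ 0,
    by rw [chain17_other, chain17Other_right, dif_pos (by simpa using hk)]; rfl, rfl, rfl⟩

/-- kernel: **the bare (1.7)-chain is connected.** [cite: Balaban1983Higgs3, (1.7) p.413, (1.21) p.416] -/
theorem chain17_isConnected (nbar m : ℕ) : IsConnected (chain17 nbar m) := by
  refine isConnected_of_root (⟨0, by omega⟩ : Fin (m + 2)) fun j => ?_
  obtain ⟨k, hk⟩ := j
  change k < m + 2 at hk
  induction k with
  | zero => exact ReflTransGen.refl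
  | succ k ih => exact ReflTransGen.tail (ih (by omega)) (chain17_adj_succ nbar m k hk)

/-- kernel: the bare (1.7)-chain has orders (d_s, d_v) = (0, 0) (the bare vertex (1.7) carries no coupling:
`B3ClassOrders420.orders_v17_bare`). [cite: Balaban1983Higgs3, (1.7) p.413, p.420] -/
theorem chain17_orders (nbar m : ℕ) : orders (chain17 nbar m) = (0, 0) := by
  rw [orders_eq_sum]
  simp [chain17, VertexKind.ds, VertexKind.dv]

/-- kernel: the chain has `m + 2` vertices, all of kind (1.7) (so none of kind (1.13)). [cite: Balaban1983Higgs3, (1.7) p.413] -/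
theorem chain17_nV_kind (nbar m : ℕ) :
    (chain17 nbar m).nV = m + 2 ∧ (∀ i, (chain17 nbar m).kind i = .v17) := ⟨rfl, fun _ => rfl⟩

/-- **The counterterm proviso of `nV_le_of_isConnected` is needed**: without counting the orders of the counterterms
carried by the vertices (1.7), the connected graphs of orders (d_s, d_v) = (0, 0) that are not made of (1.13)-vertices are
already INFINITELY MANY on p18's carrier (the bare (1.7)-chains of every length). [cite: Balaban1983Higgs3, (1.7) p.413, p.420] -/
theorem not_finite_connected_orders_zero (nbar : ℕ) :
    ¬ Set.Finite {G : Graph nbar | IsConnected G ∧ (∃ j, G.kind j ≠ .v113) ∧ dsG G + dvG G ≤ 0} := by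
  intro hfin
  have hsub : Set.range (chain17 nbar) ⊆ {G : Graph nbar | IsConnected G ∧ (∃ j, G.kind j ≠ .v113) ∧ dsG G + dvG G ≤ 0} := by
    rintro _ ⟨m, rfl⟩
    refine ⟨chain17_isConnected nbar m, ⟨(⟨0, by omega⟩ : Fin (m + 2)), by simp [chain17]⟩, ?_⟩
    have h := chain17_orders nbar m
    simp only [orders, Prod.mk.injEq] at h
    omega
  have hinj : Function.Injective (chain17 nbar) := fun m m' h => by
    have := congrArg Graph.nV h
    simpa [chain17] using this
  exact Set.infinite_range_of_injective hinj (hfin.subset hsub)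

end Witness

end Literature.MathematicalPhysics.QuantumFieldTheory.Balaban1983to89.B3GraphFiniteOrder
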